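import Summits.QuantumAdvantage.AdviceFreeQNC0.AffBells22FrameJunta
import Summits.QuantumAdvantage.AdviceFreeQNC0.AffBells22CoordProduct
import Summits.QuantumAdvantage.AdviceFreeQNC0.AffBells22HardcoreWords
import Summits.QuantumAdvantage.AdviceFreeQNC0.KernelFibrationMoves
import HarnessLib

/-!
# Sketch22 §2c (frame averaging), step F1: the per-fibre twist bound

For the frame-averaging error term one needs, for a frozen `1`-junta strategy `y` and a
frequency `γ : Fin N → ZMod 3`, a bound on the twisted sign sum
`Σ_{x odd} (−1)^{⟨J(x), stake(y,x)⟩} ω^{⟨γ,x⟩}`.  We organise the odd patterns by their kernel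
line `J = J(x)` (`Fib19.kline`): the fibre of `J` consists of the patterns with the *forced* bits
`x_b = J_{b−1} ⊕ J_{b+1}` on `supp J` and free coins off it (`Fib19.kline_eq_iff_inKernel`,
`Fib19.inKernel_iff_forced`), parametrised by `TwoModuli.glue`.  On the fibre

* the sign `(−1)^{⟨J, stake⟩}` is a *coordinate product* of the coins (each factor reads at most
  one bit: `isCoordProduct_fibreSign`),
* the oddness indicator is `(1 − Π_i (−1)^{[x_i=0]})/2`, again a coordinate product,
* the character splits as `ω^{⟨γ_A, forced⟩} · ω^{⟨γ_P, v⟩}`,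

so `AffBells22.norm_sum_coordProduct_mul_char_le` bounds the fibre sum by
`Π_{i ∉ supp J} (√3 if γ_i ≠ 0 else 2) = wordWt w_γ J` (`norm_fibre_twist_le`).  Summing over the
hard-core words `J` is step F2 (`AffBells22FrozenTwist`).
-/

namespace Summit.QuantumAdvantage.AdviceFreeQNC0

open Finset Literature.Computability.QuantumComplexity Literature.Computability.QuantumComplexity.RingHLF
open Literature.Computability.MetaComplexity

namespace AffBells22

variable {N : ℕ}

/-! ## The fibre over a kernel line: forced bits and free coins -/

/-- The active positions (support) of a kernel line. -/
def act (J : Fin N → Bool) : Finset (Fin N) := univ.filter fun b => J b = true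

/-- The forced bit `x_b = J_{b−1} ⊕ J_{b+1}` (meaningful on the support of `J`). -/
def forced (J : Fin N → Bool) (b : Fin N) : Bool := xor (J (prv b)) (J (nxt b))

/-- The pattern with forced bits on the support of `J` and free coins `v` elsewhere. -/
def gv (J : Fin N → Bool) (v : {i // i ∉ act J} → Bool) : Fin N → Bool :=
  TwoModuli.glue (act J) (fun b => forced J b) v

/-- Membership in the support. -/
theorem mem_act {J : Fin N → Bool} {b : Fin N} : b ∈ act J ↔ J b = true := by simp [act]

/-- The fibre `{x odd : J(x) = J}` of a kernel line `J = J(x₀)`: odd patterns with the forced bits on `supp J`. -/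
theorem mem_fibre_iff (hN : 3 ≤ N) {x₀ : Fin N → Bool} (hx₀ : Fib19.IsOdd x₀) (x : Fin N → Bool) :
    (Fib19.IsOdd x ∧ Fib19.kline x = Fib19.kline x₀)
      ↔ (Fib19.IsOdd x ∧ ∀ b ∈ act (Fib19.kline x₀), x b = forced (Fib19.kline x₀) b) := by
  have hHC := Fib19.kline_hardCore hN x₀ hx₀
  have hne := Fib19.kline_ne_zero hN x₀ hx₀
  constructor
  · rintro ⟨hodd, hk⟩
    refine ⟨hodd, ?_⟩
    have hK := (Fib19.kline_eq_iff_inKernel hN x hodd hne).mp hk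
    rw [Fib19.inKernel_iff_forced _ hHC.1] at hK
    intro b hb
    exact hK b (mem_act.mp hb)
  · rintro ⟨hodd, hf⟩
    refine ⟨hodd, ?_⟩
    rw [Fib19.kline_eq_iff_inKernel hN x hodd hne, Fib19.inKernel_iff_forced _ hHC.1]
    intro b hb
    exact hf b (mem_act.mpr hb)

/-- Sum over the fibre = sum over the free coins of the forced pattern (with the oddness indicator). -/
theorem sum_fibre_eq (hN : 3 ≤ N) {x₀ : Fin N → Bool} (hx₀ : Fib19.IsOdd x₀) (Φ : (Fin N → Bool) → ℂ) :
    ∑ x ∈ ((univ : Finset (Fin N → Bool)).filter fun x => Fib19.IsOdd x).filter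
        (fun x => Fib19.kline x = Fib19.kline x₀), Φ x
      = ∑ v : {i // i ∉ act (Fib19.kline x₀)} → Bool,
          (if Fib19.IsOdd (gv (Fib19.kline x₀) v) then Φ (gv (Fib19.kline x₀) v) else 0) := by
  set J := Fib19.kline x₀ with hJ
  rw [Finset.filter_filter, sum_filter]
  rw [sum_congr rfl fun x _ => by rw [if_congr (mem_fibre_iff hN hx₀ x) rfl rfl]]
  rw [TwoModuli.sum_eq_sum_sum_glue (act J)]
  refine sum_congr rfl fun v _ => ?_
  -- the inner sum over the bits on `act J` has a single non-zero term: the forced bits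
  rw [Finset.sum_eq_single (fun b : {i // i ∈ act J} => forced J b)]
  · have hall : ∀ b ∈ act J, gv J v b = forced J b := fun b hb => TwoModuli.glue_apply_mem _ _ hb
    change (if Fib19.IsOdd (gv J v) ∧ ∀ b ∈ act J, gv J v b = forced J b then Φ (gv J v) else 0) = _
    by_cases h : Fib19.IsOdd (gv J v)
    · rw [if_pos h, if_pos ⟨h, hall⟩]
    · rw [if_neg h, if_neg (fun h' => h h'.1)]
  · intro w _ hw
    rw [if_neg]
    rintro ⟨_, hf⟩
    apply hw
    funext b
    have := hf b b.2
    rwa [TwoModuli.glue_apply_mem _ _ b.2] at this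
  · intro h; exact absurd (mem_univ _) h

/-! ## Coordinate products on the fibre -/

/-- A Boolean function reading at most one bit of the pattern is, on the fibre, a sign function of at most one coin. -/
theorem isCoordProduct_sgnB_reader (J : Fin N → Bool) (S : Finset (Fin N)) (hS : S.card ≤ 1)
    (r : (Fin N → Bool) → Bool) (hr : ReadsOnly S r) :
    IsCoordProduct (fun v : {i // i ∉ act J} → Bool => sgnB (r (gv J v))) := by
  rcases Nat.le_one_iff_eq_zero_or_eq_one.mp hS with h0 | h1
  · -- reads nothing: constant
    have hconst : ∀ v, r (gv J v) = r (gv J fun _ => false) :=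
      fun v => hr _ _ (fun i hi => by rw [Finset.card_eq_zero.mp h0] at hi; exact absurd hi (by simp))
    have : (fun v : {i // i ∉ act J} → Bool => sgnB (r (gv J v))) = fun _ => sgnB (r (gv J fun _ => false)) := by
      funext v; rw [hconst v]
    rw [this]
    exact isCoordProduct_const (sgnB_cases _)
  · obtain ⟨q, hq⟩ := Finset.card_eq_one.mp h1
    by_cases hqA : q ∈ act J
    · -- reads a forced bit: constant
      have hconst : ∀ v, r (gv J v) = r (gv J fun _ => false) := by
        intro v
        refine hr _ _ fun i hi => ?_
        rw [hq, mem_singleton] at hi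
        subst hi
        unfold gv
        rw [TwoModuli.glue_apply_mem _ _ hqA, TwoModuli.glue_apply_mem _ _ hqA]
      have : (fun v : {i // i ∉ act J} → Bool => sgnB (r (gv J v))) = fun _ => sgnB (r (gv J fun _ => false)) := by
        funext v; rw [hconst v]
      rw [this]
      exact isCoordProduct_const (sgnB_cases _)
    · -- reads the coin `q`
      set H : Bool → ℂ := fun c => sgnB (r (gv J (Function.update (fun _ => false) ⟨q, hqA⟩ c))) with hH
      have hval : ∀ v, sgnB (r (gv J v)) = H (v ⟨q, hqA⟩) := by
        intro v
        simp only [hH]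
        congr 1
        refine hr _ _ fun i hi => ?_
        rw [hq, mem_singleton] at hi
        subst hi
        unfold gv
        rw [TwoModuli.glue_apply_not_mem _ _ hqA, TwoModuli.glue_apply_not_mem _ _ hqA, Function.update_self]
      have : (fun v : {i // i ∉ act J} → Bool => sgnB (r (gv J v))) = fun v => H (v ⟨q, hqA⟩) := by
        funext v; exact hval v
      rw [this]
      exact isCoordProduct_single _ H (fun c => sgnB_cases _)

/-- Reading one fixed bit. -/
theorem readsOnly_apply (b : Fin N) : ReadsOnly {b} (fun x : Fin N → Bool => x b) :=
  fun _ _ h => h b (mem_singleton_self b)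

/-- Reading the complement of one fixed bit. -/
theorem readsOnly_not_apply (b : Fin N) : ReadsOnly {b} (fun x : Fin N → Bool => !x b) :=
  fun _ _ h => congrArg (fun c : Bool => !c) (h b (mem_singleton_self b))

/-- **The fibre sign of a frozen `1`-junta strategy is a coordinate product of the coins.** -/
theorem isCoordProduct_fibreSign (J : Fin N → Bool) (T : Fin N → Finset (Fin N)) (y : Fin N → (Fin N → Bool) → Bool)
    (hT : ∀ k, (T k).card ≤ 1) (hy : ∀ k, ReadsOnly (T k) (y k)) :
    IsCoordProduct (fun v : {i // i ∉ act J} → Bool =>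
      (-1 : ℂ) ^ dot2 J (Fib19.stake (fun x k => y k x) (gv J v))) := by
  have hform : ∀ v : {i // i ∉ act J} → Bool,
      (-1 : ℂ) ^ dot2 J (Fib19.stake (fun x k => y k x) (gv J v))
        = ∏ b ∈ act J, (sgnB (y b (gv J v)) * sgnB ((gv J v) b) * sgnB ((gv J v) (nxt b))) := by
    intro v
    unfold dot2
    rw [← neg_one_pow_eq_pow_mod_two]
    have hfilt : (univ.filter fun b : Fin N => J b = true ∧ Fib19.stake (fun x k => y k x) (gv J v) b = true)
        = (act J).filter fun b => Fib19.stake (fun x k => y k x) (gv J v) b = true := by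
      unfold act; rw [Finset.filter_filter]
    rw [hfilt, neg_one_pow_card_filter_eq_prod_sgnB]
    refine prod_congr rfl fun b _ => ?_
    unfold Fib19.stake tGuess
    rw [sgnB_xor, sgnB_xor, mul_assoc]
  have : (fun v : {i // i ∉ act J} → Bool => (-1 : ℂ) ^ dot2 J (Fib19.stake (fun x k => y k x) (gv J v)))
      = fun v => ∏ b ∈ act J, (sgnB (y b (gv J v)) * sgnB ((gv J v) b) * sgnB ((gv J v) (nxt b))) := by
    funext v; exact hform v
  rw [this]
  refine isCoordProduct_prod _ _ fun b _ => ?_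
  exact ((isCoordProduct_sgnB_reader J (T b) (hT b) (y b) (hy b)).mul
    (isCoordProduct_sgnB_reader J {b} (by simp) (fun x => x b) (readsOnly_apply b))).mul
    (isCoordProduct_sgnB_reader J {nxt b} (by simp) (fun x => x (nxt b)) (readsOnly_apply (nxt b)))

/-- The oddness indicator on the fibre: `[IsOdd x] = (1 − Π_i (−1)^{[x_i = 0]})/2`, a coordinate-product combination. -/
theorem isOdd_indicator_eq (x : Fin N → Bool) :
    (if Fib19.IsOdd x then (1 : ℂ) else 0) = (1 - ∏ i : Fin N, sgnB (!x i)) / 2 := by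
  have hz : (-1 : ℂ) ^ Fib19.zeros x = ∏ i : Fin N, sgnB (!x i) := by
    unfold Fib19.zeros
    rw [← neg_one_pow_card_filter_eq_prod_sgnB]
    congr 2
    exact filter_congr fun i _ => by simp
  rw [← hz]
  by_cases h : Fib19.IsOdd x
  · rw [if_pos h]
    have h1 : Fib19.zeros x % 2 = 1 := (Fib19.isOdd_iff x).mp h
    rw [neg_one_pow_eq_pow_mod_two, h1]; norm_num
  · rw [if_neg h]
    have h0 : Fib19.zeros x % 2 = 0 := by
      have := (Fib19.isOdd_iff x).not.mp h; omega
    rw [neg_one_pow_eq_pow_mod_two, h0]; norm_num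

/-- The zeros sign `Π_i (−1)^{[x_i = 0]}` is a coordinate product of the coins. -/
theorem isCoordProduct_zerosSign (J : Fin N → Bool) :
    IsCoordProduct (fun v : {i // i ∉ act J} → Bool => ∏ i : Fin N, sgnB (!(gv J v) i)) :=
  isCoordProduct_prod _ _ fun i _ => isCoordProduct_sgnB_reader J {i} (by simp) (fun x => !x i) (readsOnly_not_apply i)

/-- The linear form splits along the support: `⟨γ, gv v⟩ = ⟨γ_A, forced⟩ + ⟨γ_P, v⟩`. -/
theorem char_split (J : Fin N → Bool) (γ : Fin N → ZMod 3) (v : {i // i ∉ act J} → Bool) :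
    (∑ i : Fin N, if gv J v i then γ i else 0)
      = (∑ k : {i // i ∈ act J}, if forced J k then γ k else 0)
        + (∑ k : {i // i ∉ act J}, if v k then γ k else 0) := by
  have e1 : (∑ k : {i // i ∈ act J}, if forced J k then γ k else 0)
      = ∑ k : {i // i ∈ act J}, if gv J v k then γ k else 0 :=
    sum_congr rfl fun k _ => by unfold gv; rw [TwoModuli.glue_apply_mem _ _ k.2]
  have e2 : (∑ k : {i // i ∉ act J}, if v k then γ k else 0)
      = ∑ k : {i // i ∉ act J}, if gv J v k then γ k else 0 :=
    sum_congr rfl fun k _ => by unfold gv; rw [TwoModuli.glue_apply_not_mem _ _ k.2]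
  rw [e1, e2, ← Finset.sum_subtype (act J) (fun _ => Iff.rfl) (f := fun i => if gv J v i then γ i else 0),
    ← Finset.sum_subtype (p := fun i => i ∉ act J) (act J)ᶜ (fun _ => Finset.mem_compl)
      (f := fun i => if gv J v i then γ i else 0),
    Finset.sum_add_sum_compl]

/-! ## The per-fibre twist bound -/

/-- The coin weights `√3` on the support of `γ`, `2` elsewhere (positions coded in `ℕ`). -/
noncomputable def wtGamma (γ : Fin N → ZMod 3) (n : ℕ) : ℝ :=
  if n ∈ (univ.filter fun i : Fin N => γ i ≠ 0).map Fin.valEmbedding then Real.sqrt 3 else 2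

/-- The coin weight at an actual position. -/
theorem wtGamma_val (γ : Fin N → ZMod 3) (i : Fin N) : wtGamma γ i.val = if γ i ≠ 0 then Real.sqrt 3 else 2 := by
  unfold wtGamma
  have hmem : (i.val ∈ (univ.filter fun i : Fin N => γ i ≠ 0).map Fin.valEmbedding) ↔ γ i ≠ 0 := by
    rw [Finset.mem_map]
    constructor
    · rintro ⟨k, hk, hkv⟩
      have : k = i := Fin.ext (by simpa using hkv)
      subst this
      exact (mem_filter.mp hk).2
    · intro hi
      exact ⟨i, mem_filter.mpr ⟨mem_univ _, hi⟩, rfl⟩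
  simp only [hmem]

/-- **PER-FIBRE TWIST BOUND**: on the fibre of `J = J(x₀)`,
`‖Σ_{x odd, J(x) = J} (−1)^{⟨J, stake(y,x)⟩} ω^{⟨γ,x⟩}‖ ≤ Π_{i : J_i = 0} w_γ(i)` (`√3` on `supp γ`, `2` off it). -/
theorem norm_fibre_twist_le (hN : 3 ≤ N) {x₀ : Fin N → Bool} (hx₀ : Fib19.IsOdd x₀) (T : Fin N → Finset (Fin N))
    (y : Fin N → (Fin N → Bool) → Bool) (hT : ∀ k, (T k).card ≤ 1) (hy : ∀ k, ReadsOnly (T k) (y k))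
    (γ : Fin N → ZMod 3) :
    ‖∑ x ∈ ((univ : Finset (Fin N → Bool)).filter fun x => Fib19.IsOdd x).filter
        (fun x => Fib19.kline x = Fib19.kline x₀),
        (-1 : ℂ) ^ dot2 (Fib19.kline x) (Fib19.stake (fun x k => y k x) x)
          * (ZMod.stdAddChar (∑ i : Fin N, if x i then γ i else 0) : ℂ)‖
      ≤ wordWt (wtGamma γ) (Fib19.kline x₀) := by
  set J := Fib19.kline x₀ with hJ
  -- rewrite `kline x` as `J` on the fibre, then pass to the coins
  have hrw : ∑ x ∈ ((univ : Finset (Fin N → Bool)).filter fun x => Fib19.IsOdd x).filter (fun x => Fib19.kline x = J),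
      (-1 : ℂ) ^ dot2 (Fib19.kline x) (Fib19.stake (fun x k => y k x) x)
        * (ZMod.stdAddChar (∑ i : Fin N, if x i then γ i else 0) : ℂ)
      = ∑ x ∈ ((univ : Finset (Fin N → Bool)).filter fun x => Fib19.IsOdd x).filter (fun x => Fib19.kline x = J),
      (-1 : ℂ) ^ dot2 J (Fib19.stake (fun x k => y k x) x)
        * (ZMod.stdAddChar (∑ i : Fin N, if x i then γ i else 0) : ℂ) := by
    refine sum_congr rfl fun x hx => ?_
    rw [(mem_filter.mp hx).2]
  rw [hrw, sum_fibre_eq hN hx₀]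
  -- the three coordinate products
  set S : ({i // i ∉ act J} → Bool) → ℂ := fun v => (-1 : ℂ) ^ dot2 J (Fib19.stake (fun x k => y k x) (gv J v)) with hS
  set P : ({i // i ∉ act J} → Bool) → ℂ := fun v => ∏ i : Fin N, sgnB (!(gv J v) i) with hP
  have hSc : IsCoordProduct S := isCoordProduct_fibreSign J T y hT hy
  have hPc : IsCoordProduct P := isCoordProduct_zerosSign J
  set cA : ℂ := (ZMod.stdAddChar (∑ k : {i // i ∈ act J}, if forced J k then γ k else 0) : ℂ) with hcA
  set γ' : {i // i ∉ act J} → ZMod 3 := fun k => γ k with hγ'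
  have hterm : ∀ v : {i // i ∉ act J} → Bool,
      (if Fib19.IsOdd (gv J v) then (-1 : ℂ) ^ dot2 J (Fib19.stake (fun x k => y k x) (gv J v))
          * (ZMod.stdAddChar (∑ i : Fin N, if gv J v i then γ i else 0) : ℂ) else 0)
        = cA / 2 * (S v * (ZMod.stdAddChar (∑ k, if v k then γ' k else 0) : ℂ))
          - cA / 2 * ((P v * S v) * (ZMod.stdAddChar (∑ k, if v k then γ' k else 0) : ℂ)) := by
    intro v
    have hind := isOdd_indicator_eq (gv J v)
    rw [char_split, AddChar.map_add_eq_mul]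
    by_cases h : Fib19.IsOdd (gv J v)
    · rw [if_pos h] at hind ⊢
      have hP1 : P v = -1 := by
        have : (1 : ℂ) = (1 - P v) / 2 := hind
        linear_combination 2 * this
      rw [hP1]; simp only [hS, hcA, hγ']; ring
    · rw [if_neg h] at hind ⊢
      have hP1 : P v = 1 := by
        have : (0 : ℂ) = (1 - P v) / 2 := hind
        linear_combination 2 * this
      rw [hP1]; ring
  rw [sum_congr rfl fun v _ => hterm v, sum_sub_distrib, ← mul_sum, ← mul_sum]
  have hB := norm_sum_coordProduct_mul_char_le hSc γ'
  have hB' := norm_sum_coordProduct_mul_char_le (hPc.mul hSc) γ'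
  have hcAn : ‖cA / 2‖ = 1 / 2 := by
    rw [norm_div, hcA, AffBells21.norm_stdAddChar_three]; simp
  -- the product bound equals the word weight
  have hprod : ∏ k : {i // i ∉ act J}, (if γ' k ≠ 0 then Real.sqrt 3 else 2) = wordWt (wtGamma γ) J := by
    show (∏ k : {i // i ∉ act J}, (if γ k ≠ 0 then Real.sqrt 3 else 2)) = _
    unfold wordWt
    rw [← Finset.prod_subtype (p := fun i => i ∉ act J) (act J)ᶜ (fun _ => Finset.mem_compl)
      (f := fun i => if γ i ≠ 0 then Real.sqrt 3 else 2),
      ← Finset.prod_filter_mul_prod_filter_not univ (fun i => J i = false)]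
    have h1 : (act J)ᶜ = (univ.filter fun i : Fin N => J i = false) := by
      ext i; simp [act]
    have h2 : ∏ i ∈ univ.filter (fun i : Fin N => ¬ J i = false),
        (if J i = false then wtGamma γ i.val else 1) = 1 :=
      prod_eq_one fun i hi => by rw [if_neg (mem_filter.mp hi).2]
    rw [h1, h2, mul_one]
    refine prod_congr rfl fun i hi => ?_
    rw [if_pos (mem_filter.mp hi).2, wtGamma_val]
  calc ‖cA / 2 * ∑ v, S v * (ZMod.stdAddChar (∑ k, if v k then γ' k else 0) : ℂ)
        - cA / 2 * ∑ v, (P v * S v) * (ZMod.stdAddChar (∑ k, if v k then γ' k else 0) : ℂ)‖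
      ≤ ‖cA / 2 * ∑ v, S v * (ZMod.stdAddChar (∑ k, if v k then γ' k else 0) : ℂ)‖
        + ‖cA / 2 * ∑ v, (P v * S v) * (ZMod.stdAddChar (∑ k, if v k then γ' k else 0) : ℂ)‖ := norm_sub_le _ _
    _ ≤ 1 / 2 * wordWt (wtGamma γ) J + 1 / 2 * wordWt (wtGamma γ) J := by
        rw [norm_mul, norm_mul, hcAn, ← hprod]
        exact add_le_add (mul_le_mul_of_nonneg_left hB (by norm_num)) (mul_le_mul_of_nonneg_left hB' (by norm_num))
    _ = wordWt (wtGamma γ) J := by ring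

end AffBells22

end Summit.QuantumAdvantage.AdviceFreeQNC0
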